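import Summits.Ventures.PercRepro.Night2LocalD3TwoTwoD
import Summits.Ventures.PercRepro.Night2LocalD3ThreeTwoE
import Summits.Ventures.PercRepro.Night2LocalKColoops

/-!
# PercRepro — **THE CELL `kColoops = 2` OF `|E ∖ G| = 3` AT `q = 4` IS CLOSED**; the `(6, 4)` row modulo `kColoops ≤ 1` (night-2, gen 13)

`localShadowHall_d3_k2`: for a loopless simple `M`, a rank-`5` flat `G` with `|E ∖ G| = 3` and exactly two coloops of `M|G`, the
local form (LI_G) holds — by the distance-2 rule (`localShadowHall_of_distance_two`), whose column condition is checked at every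
shadow set by the number `a` of its coloops: `a = 2` (`load2_le_cap2_two_two`), `a = 3` (`load2_le_cap2_three_two`), `a = 4`
(`ex2_eq_empty_of_card_coloops_eq_four`), `a ≥ 5` (no series pair, `two_mul_card_ex2_le`); `a ≥ 2` since `K ⊆ coloops S`.

`shadowHall_six_four_of_local_k_le_one`: the `(6, 4)` shadow row for every finite matroid, modulo (LI_G) at the rank-`5` flats with
`|E ∖ G| = 2` and `kColoops ≤ 1` and with `|E ∖ G| = 3` and `kColoops = 1` of loopless simple rank-`6` matroids.
-/

open scoped Matroid

namespace PercRepro.Shadow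

open Finset PerFlat ThmH

variable {α : Type*} [DecidableEq α] {M : Matroid α} [M.Finite]

section KTwo

variable {G S : Finset α}

open scoped Classical in
/-- Without a member carrying layer-2 weight the layer-2 load vanishes. -/
theorem load2_eq_zero_of_ex2_eq_empty {q : ℕ} (hex : ex2 M q G S = ∅) : load2 M q G S = 0 := by
  unfold load2
  apply Finset.sum_eq_zero
  intro B hB
  by_contra hne
  have hmem : B ∈ ex2 M q G S := by unfold ex2; exact Finset.mem_filter.2 ⟨hB, hne⟩
  rw [hex] at hmem
  exact Finset.notMem_empty _ hmem

open scoped Classical in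
/-- With `≥ 5` coloops a shadow set carries no series pair, hence no layer-2 weight. -/
theorem ex2_eq_empty_of_five_le_card_coloops (hG : G ∈ flatsQ M (4 + 1))
    (hS : S ∈ shadowAt M (4 + 2) 4 (Uq M (4 + 2) 4) G) (ha : 5 ≤ (coloops M S).card) : ex2 M 4 G S = ∅ := by
  have h := two_mul_card_ex2_le hG hS
  have h0 : (4 + 2 - (coloops M S).card) * (4 + 1 - (coloops M S).card) = 0 := by
    have : 4 + 1 - (coloops M S).card = 0 := by omega
    rw [this, mul_zero]
  rw [h0] at h
  exact Finset.card_eq_zero.1 (by omega)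

open scoped Classical in
/-- **THE CELL `kColoops = 2` OF `|E ∖ G| = 3` AT `q = 4`**: the local form (LI_G) holds. -/
theorem localShadowHall_d3_k2 (hs : ∀ e ∈ gr M, ∀ f ∈ gr M, e ≠ f → rkN M {e, f} = 2)
    (hl : ∀ e ∈ gr M, M.Indep {e}) (hG : G ∈ flatsQ M (4 + 1)) (hd : (gr M \ G).card = 3)
    (hk : kColoops M G = 2) : LocalShadowHall M 4 G := by
  apply localShadowHall_of_distance_two hG (by omega)
  intro S hS
  have hcap0 : 0 ≤ capS M 4 G S := capS_nonneg' hG (by omega) S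
  have ha2 : 2 ≤ (coloops M S).card := hk ▸ kColoops_le_card_coloops hS
  rcases Nat.lt_or_ge (coloops M S).card 3 with h3 | h3
  · exact load2_le_cap2_two_two hs hl hG hd hk hS (by omega)
  rcases Nat.lt_or_ge (coloops M S).card 4 with h4 | h4
  · exact load2_le_cap2_three_two hs hG hd hk hS (by omega)
  rcases Nat.lt_or_ge (coloops M S).card 5 with h5 | h5
  · rw [load2_eq_zero_of_ex2_eq_empty (ex2_eq_empty_of_card_coloops_eq_four hs hG hS (by omega))]
    exact cap2_nonneg hcap0
  · rw [load2_eq_zero_of_ex2_eq_empty (ex2_eq_empty_of_five_le_card_coloops hG hS h5)]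
    exact cap2_nonneg hcap0

end KTwo

section SixFour

variable {α' : Type} [DecidableEq α']

/-- **THE `(6, 4)` SHADOW ROW FOR EVERY FINITE MATROID, MODULO `|E ∖ G| = 2` WITH `kColoops ≤ 1` AND `|E ∖ G| = 3` WITH
`kColoops = 1`** of loopless simple rank-`6` matroids. -/
theorem shadowHall_six_four_of_local_k_le_one
    (hloc2 : ∀ (N : Matroid α') [N.Finite], (∀ e ∈ gr N, ∀ f ∈ gr N, e ≠ f → rkN N {e, f} = 2) →
      (∀ e ∈ gr N, N.Indep {e}) → N.eRank = ((6 : ℕ) : ℕ∞) →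
      ∀ G ∈ flatsQ N (4 + 1), (gr N \ G).card = 2 → kColoops N G ≤ 1 → LocalShadowHall N 4 G)
    (hloc3 : ∀ (N : Matroid α') [N.Finite], (∀ e ∈ gr N, ∀ f ∈ gr N, e ≠ f → rkN N {e, f} = 2) →
      (∀ e ∈ gr N, N.Indep {e}) → N.eRank = ((6 : ℕ) : ℕ∞) →
      ∀ G ∈ flatsQ N (4 + 1), (gr N \ G).card = 3 → kColoops N G = 1 → LocalShadowHall N 4 G)
    (M : Matroid α') [M.Finite] : ShadowHall M 6 4 (phiK 6 4) := by
  apply shadowHall_six_four_of_local_small_k hloc2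
  intro N _ hs hl hN G hG hd h1 h2
  rcases Nat.lt_or_ge (kColoops N G) 2 with hk | hk
  · exact hloc3 N hs hl hN G hG hd (by omega)
  · exact localShadowHall_d3_k2 hs hl hG hd (by omega)

end SixFour

end PercRepro.Shadow
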